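import Literature.AlgebraicGeometry.Resolution.EmbeddedResolutionCentre
import HarnessLib

/-!
# Embedded desingularization with centres over the subvariety itself ⇒ resolution
# (crux `PatchingRel`, stmt-ResolutionOfSingularities-0642, line `Ideator5Sketch`: the collapse lemma)

The tree's BGMW §3.3 (3) ⇒ (4) theorem `hasResolution_of_isEmbeddedTransform`
(`Literature/…/EmbeddedResolution.lean`) turns a sequence of blow-ups of a locally Noetherian
`X` in regular centres lying over a set `T` NOT containing the generic point `ξ` of the integral
closed subscheme `ι : Y ↪ X`, whose iterated strict transform is regular, into a resolution of
`Y`. The CJS-format statement `EmbResCodimTwo` of the line `Ideator5Sketch` (crux-ideate r2 k5,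
card `bad-stratum-induction`) has its centres over `T = ι(Y)` ITSELF (`IsEmbeddedTransform X X π X₁`),
so `ξ ∈ T` and that theorem does not apply verbatim: a centre may pass through the point over `ξ`
and swallow the strict transform, after which the recorded strict transform is empty. This file
proves the generalisation to `T ⊆ ι(Y)`: along the sequence, EITHER no centre has yet met the
fibre over `ξ` — then `σ` is an isomorphism over an open `V ∋ ξ` and the strict transform is
`closure {ξ'}` for the point `ξ'` over `ξ` — OR at the first step where a (regular) centre `V(C)`
meets that fibre, `V(C)` lies over `ι(Y)`, hence coincides with the strict transform over `V`,
so the strict transform at that stage is an open-and-closed piece of the regular scheme `V(C)`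
(the tree's `Scheme.IsRegular.subscheme_vanishingIdeal_closure`), i.e. it is ALREADY regular,
and composed with `σ` it resolves `Y` (BGMW §3.3 (2) ⇒ (3) ⇒ (4)). Consequently an embedded
transform over `T ⊆ ι(Y)` with regular final strict transform always yields a resolution of `Y`
(`hasResolution_of_isEmbeddedTransform_of_subset`).

## Contents (namespace `Summit.ResolutionOfSingularities.ResolutionOfSingularities.Theorems`)

* `hasResolution_of_isIso_over_generic` — the (3) ⇒ (4) mechanism from explicit data: `σ : X' → X`
  proper, an isomorphism over an open `V ∋ ξ = ι(η_Y)`, a point `ξ'` over `ξ` whose closure with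
  its reduced structure is regular ⇒ `Y` has a resolution.
* `isRegular_subscheme_closure_of_centre` — (2) ⇒ (3) from explicit data: if moreover a regular
  centre `V(C) ⊆ X'` lies over `closure {ξ}` and contains `ξ'`, then `closure {ξ'}` with its
  reduced structure is regular.
* `isProper_and_exists_or_hasResolution` — the induction over `IsEmbeddedTransform (range ι) T σ Y'`
  for `T ⊆ range ι`.
* `hasResolution_of_isEmbeddedTransform_of_subset` — the generalised BGMW (3) ⇒ (4).

## Sources

* E. Bierstone, D. Grigoriev, P. Milman, J. Włodarczyk, *Effective Hironaka resolution and its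
  complexity*, Asian J. Math. 15 (2011) = arXiv:1206.3090, §3.3 (2) ⇒ (3) ⇒ (4), Thm. 2.0.2,
  Thm. 2.0.3. [BierstoneGrigorievMilmanWlodarczyk2011]
* V. Cossart, U. Jannsen, S. Saito, *Desingularization: invariants and strategy*, LNM 2270
  (2020), Thm. 1.4 (centres inside the subscheme being resolved). [CossartJannsenSaito2020]
-/

-- `Summit.<Summit>.<Sub>[.Theorems]` with `Sub = Summit` (single-conjunct summit, D-0017).
set_option linter.dupNamespace false

noncomputable section

namespace Summit.ResolutionOfSingularities.ResolutionOfSingularities.Theorems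

open CategoryTheory AlgebraicGeometry TopologicalSpace Topology
open Literature.AlgebraicGeometry.Resolution
open Scheme.IdealSheafData

universe u

variable {X : Scheme.{u}}

/-! ## (3) ⇒ (4) from explicit data -/

/-- **BGMW §3.3 (3) ⇒ (4) from explicit data.** Let `ι : Y ↪ X` be a closed immersion of an
integral scheme, `σ : X' → X` proper and an isomorphism over an open `V` containing
`ξ = ι(η_Y)`, and `ξ' ∈ X'` a point over `ξ`. If the reduced closed subscheme `Ỹ` of `X'` on
`closure {ξ'}` is regular, then `Ỹ → Y` (the factorisation of `Ỹ ↪ X' → X` through `ι`) is a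
resolution of singularities of `Y`: proper, birational (a surjective closed immersion onto the
reduced `ι⁻¹ V`, hence an isomorphism over it), with regular source. The argument is the tree's
`hasResolution_of_isEmbeddedTransform` with its first line (the appeal to
`IsEmbeddedTransform.isProper_and_exists`) replaced by hypotheses.
[cite: BierstoneGrigorievMilmanWlodarczyk2011, §3.3 (3)⇒(4) and Thm. 2.0.3] -/
theorem hasResolution_of_isIso_over_generic {Y X' : Scheme.{u}} [IsIntegral Y] (ι : Y ⟶ X)
    [IsClosedImmersion ι] (σ : X' ⟶ X) [IsProper σ] (V : X.Opens)
    (hξV : ι (genericPoint Y) ∈ V) (hiso : IsIso (σ ∣_ V)) (ξ' : X')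
    (hξ' : σ ξ' = ι (genericPoint Y))
    (hreg : Scheme.IsRegular
      (vanishingIdeal (⟨closure {ξ'}, isClosed_closure⟩ : Closeds X')).subscheme) :
    Scheme.HasResolution Y := by
  classical
  -- `ι(Y)` is the closure of the image `ξ` of the generic point of `Y`
  set ξ : X := ι (genericPoint Y) with hξdef
  have hgen : IsGenericPoint ξ (Set.range ι) := by
    have := (genericPoint_spec Y).image ι.continuous
    rwa [Set.image_univ, ι.isClosedEmbedding.isClosed_range.closure_eq] at this
  have hYξ : Set.range ι = closure {ξ} := hgen.symm
  -- the strict transform `Z = closure {ξ'}` and its reduced structure `Ỹ`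
  set Z : Closeds X' := ⟨closure {ξ'}, isClosed_closure⟩ with hZdef
  have hZ : (Z : Set X') = closure {ξ'} := rfl
  let j := (vanishingIdeal Z).subschemeι
  haveI : IsIntegral (vanishingIdeal Z).subscheme :=
    isIntegral_subscheme_vanishingIdeal Z (hZ ▸ isIrreducible_singleton.closure)
  have hrange : Set.range j = closure {ξ'} := by
    rw [range_subschemeι, coe_support_vanishingIdeal, hZ]
  -- `σ ∘ j` factors through `ι`
  have hker : ι.ker ≤ (j ≫ σ).ker := by
    have e1 : (j ≫ σ).ker = vanishingIdeal (.closure (σ '' (Z : Set X'))) := by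
      rw [← map_vanishingIdeal]
      rfl
    rw [e1, ← le_support_iff_le_vanishingIdeal]
    have e2 : (ι.ker.support : Set X) = Set.range ι := by
      rw [Scheme.Hom.support_ker, ι.isClosedEmbedding.isClosed_range.closure_eq]
    rw [← SetLike.coe_subset_coe, e2, Closeds.closure]
    change closure (σ '' (Z : Set X')) ⊆ Set.range ι
    rw [hYξ, hZ]
    refine closure_minimal ((image_closure_subset_closure_image σ.continuous).trans ?_)
      isClosed_closure
    rw [Set.image_singleton, hξ']
  let ρ : (vanishingIdeal Z).subscheme ⟶ Y := IsClosedImmersion.lift ι (j ≫ σ) hker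
  have hρ : ρ ≫ ι = j ≫ σ := IsClosedImmersion.lift_fac ι (j ≫ σ) hker
  have hρapp : ∀ y, ι (ρ y) = σ (j y) := fun y => by
    rw [← Scheme.Hom.comp_apply, hρ, Scheme.Hom.comp_apply]
  -- properness
  haveI : IsProper ρ := by
    have : IsProper (ρ ≫ ι) := by rw [hρ]; infer_instance
    exact MorphismProperty.of_postcomp (W := @IsProper) (W' := @IsSeparated) ρ ι inferInstance
      this
  -- the dense open `U = ι⁻¹ V` of `Y` and the point `y₀` of `Ỹ` over `ξ'`
  let U : Y.Opens := ι ⁻¹ᵁ V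
  have hηU : genericPoint Y ∈ U := hξV
  obtain ⟨y₀, hy₀⟩ : ξ' ∈ Set.range j := by rw [hrange]; exact subset_closure rfl
  have hfibξ : σ ⁻¹' {ξ} = {ξ'} := by
    obtain ⟨x, -, huniq⟩ := existsUnique_preimage_of_isIso_morphismRestrict σ hiso hξV
    ext z
    simp only [Set.mem_preimage, Set.mem_singleton_iff]
    exact ⟨fun hz => (huniq z hz).trans (huniq ξ' hξ').symm, fun hz => hz ▸ hξ'⟩
  -- points of `X'` over `ι(Y) ∩ V` lie in the strict transform
  have hover : ∀ x : X', σ x ∈ Set.range ι → σ x ∈ V → x ∈ closure {ξ'} := by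
    intro x hx hxV
    rw [hYξ] at hx
    have := preimage_closure_inter_subset_of_isIso_morphismRestrict σ hiso {ξ} ⟨hx, hxV⟩
    rwa [hfibξ] at this
  have hbir : IsBirational ρ := by
    refine ⟨U, ?_, ?_, ?_⟩
    · -- `U` contains the generic point of `Y`
      have hd : Dense ({genericPoint Y} : Set Y) := by
        rw [dense_iff_closure_eq]; exact genericPoint_spec Y
      exact hd.mono (Set.singleton_subset_iff.mpr hηU)
    · -- `ρ⁻¹ U` contains the generic point `y₀` of `Ỹ`
      have hgen' : closure ({y₀} : Set (vanishingIdeal Z).subscheme) = Set.univ := by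
        rw [j.isClosedEmbedding.isInducing.closure_eq_preimage_closure_image, Set.image_singleton,
          hy₀, ← hrange, Set.preimage_range]
      have hd : Dense ({y₀} : Set (vanishingIdeal Z).subscheme) := by
        rw [dense_iff_closure_eq]; exact hgen'
      refine hd.mono (Set.singleton_subset_iff.mpr ?_)
      change ι (ρ y₀) ∈ V
      rw [hρapp, hy₀, hξ']
      exact hξV
    · -- over `U`, `ρ` is a surjective closed immersion onto a reduced scheme
      haveI : IsClosedImmersion (ρ ∣_ U) := by
        have h1 : IsClosedImmersion ((j ≫ σ) ∣_ V) := by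
          rw [morphismRestrict_comp]
          haveI := hiso
          exact (MorphismProperty.cancel_right_of_respectsIso @IsClosedImmersion _ _).mpr
            (IsZariskiLocalAtTarget.restrict (inferInstanceAs (IsClosedImmersion j)) _)
        rw [← hρ, morphismRestrict_comp] at h1
        exact MorphismProperty.of_postcomp (W := @IsClosedImmersion) (W' := @IsSeparated)
          (ρ ∣_ U) (ι ∣_ V) inferInstance h1
      haveI : Surjective (ρ ∣_ U) := by
        refine ⟨fun u => ?_⟩
        have hu : ι u.1 ∈ V := u.2
        obtain ⟨x, hx, -⟩ := existsUnique_preimage_of_isIso_morphismRestrict σ hiso hu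
        have hxZ : x ∈ Set.range j := by
          rw [hrange]
          exact hover x (hx ▸ Set.mem_range_self _) (hx ▸ hu)
        obtain ⟨y₁, rfl⟩ := hxZ
        have hρy₁ : ρ y₁ = u.1 := ι.isClosedEmbedding.injective (by rw [hρapp, hx])
        refine ⟨⟨y₁, show ρ y₁ ∈ U by rw [hρy₁]; exact u.2⟩, Subtype.ext ?_⟩
        rw [morphismRestrict_base_coe]
        exact hρy₁
      exact isIso_of_isClosedImmersion_of_surjective _
  exact ⟨_, ρ, ⟨inferInstance, hbir, hreg⟩⟩

/-! ## (2) ⇒ (3) from explicit data: a regular centre through the point over `ξ` -/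

/-- **BGMW §3.3 (2) ⇒ (3) from explicit data.** Let `σ : X' → X` be an isomorphism over an open
`V ∋ ξ`, `ξ' ∈ X'` the point over `ξ`, and `V(C) ⊆ X'` a REGULAR closed subscheme lying over
`closure {ξ}` and passing through `ξ'` (`X'` locally Noetherian). Then the reduced closed
subscheme of `X'` on `closure {ξ'}` is regular: over `V`, both `V(C)` and `closure {ξ'}` coincide
with `σ⁻¹(closure {ξ})`, so `closure {ξ'}` is the closure of the open piece `V(C) ∩ σ⁻¹ V` of the
regular scheme `V(C)` (`Scheme.IsRegular.subscheme_vanishingIdeal_closure`). This is the tree's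
`IsEmbeddedTransform.isRegular_subscheme_of_centre` with its first line replaced by hypotheses.
[cite: BierstoneGrigorievMilmanWlodarczyk2011, §3.3 (2)⇒(3), p. 7] -/
theorem isRegular_subscheme_closure_of_centre {X' : Scheme.{u}} [IsLocallyNoetherian X']
    {ξ : X} (σ : X' ⟶ X) (V : X.Opens) (hξV : ξ ∈ V) (hiso : IsIso (σ ∣_ V)) (ξ' : X')
    (hξ' : σ ξ' = ξ) (C : X'.IdealSheafData) (hC : Scheme.IsRegular C.subscheme)
    (hCY : σ '' (C.support : Set X') ⊆ closure {ξ}) (hξ'C : ξ' ∈ (C.support : Set X')) :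
    Scheme.IsRegular (Scheme.IdealSheafData.vanishingIdeal
      (⟨closure {ξ'}, isClosed_closure⟩ : Closeds X')).subscheme := by
  haveI : IsLocallyNoetherian C.subscheme :=
    LocallyOfFiniteType.isLocallyNoetherian C.subschemeι
  -- the fibre of `σ` over `ξ` is `{ξ'}`
  have hfib : σ ⁻¹' {ξ} = {ξ'} := by
    obtain ⟨x, -, huniq⟩ := existsUnique_preimage_of_isIso_morphismRestrict σ hiso hξV
    ext z
    simp only [Set.mem_preimage, Set.mem_singleton_iff]
    exact ⟨fun hz => (huniq z hz).trans (huniq ξ' hξ').symm, fun hz => hz ▸ hξ'⟩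
  -- over `V`, the centre coincides with `closure {ξ'}`
  let W : X'.Opens := σ ⁻¹ᵁ V
  have hCW : (C.support : Set X') ∩ (W : Set X') = closure {ξ'} ∩ (W : Set X') := by
    apply le_antisymm
    · rintro x ⟨hxC, hxW⟩
      refine ⟨?_, hxW⟩
      have hx : σ x ∈ closure {ξ} := hCY ⟨x, hxC, rfl⟩
      have := preimage_closure_inter_subset_of_isIso_morphismRestrict σ hiso {ξ} ⟨hx, hxW⟩
      rwa [hfib] at this
    · rintro x ⟨hx, hxW⟩
      exact ⟨closure_minimal (Set.singleton_subset_iff.mpr hξ'C) C.support.isClosed hx, hxW⟩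
  have hcl : closure ((C.support : Set X') ∩ (W : Set X')) = closure {ξ'} := by
    rw [hCW]
    apply le_antisymm
    · simpa only [closure_closure] using
        closure_mono (s := closure {ξ'} ∩ (W : Set X')) (t := closure {ξ'}) Set.inter_subset_left
    · refine closure_mono (Set.singleton_subset_iff.mpr ⟨subset_closure rfl, ?_⟩)
      show σ ξ' ∈ V
      rw [hξ']
      exact hξV
  -- `closure {ξ'}` is the closure of an open piece of the regular scheme `V(C)`
  have key := hC.subscheme_vanishingIdeal_closure C.subschemeι W
  have e : (⟨closure (Set.range C.subschemeι ∩ (W : Set X')), isClosed_closure⟩ : Closeds X') =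
      ⟨closure {ξ'}, isClosed_closure⟩ := by
    apply Closeds.ext
    change closure (Set.range C.subschemeι ∩ (W : Set X')) = closure {ξ'}
    rw [Scheme.IdealSheafData.range_subschemeι, hcl]
  rwa [e] at key

/-! ## The induction over the sequence of blow-ups -/

/-- **Embedded transforms with centres over the subvariety: the dichotomy.** Let `X` be locally
Noetherian, `ι : Y ↪ X` a closed immersion of an integral scheme with generic point mapping to
`ξ`, and `σ : X' → X`, `Y' ⊆ X'` an embedded transform of `ι(Y)` along blow-ups in regular
centres lying over a set `T ⊆ ι(Y)` (`IsEmbeddedTransform (range ι) T σ Y'`). Then `σ` is proper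
(blow-ups of locally Noetherian schemes are proper, `stacks02NS_holds`), and EITHER `σ` is an
isomorphism over an open `V ∋ ξ` and `Y' = closure {ξ'}` for a point `ξ'` over `ξ` (no centre
has met the fibre over `ξ` yet), OR `Y` has a resolution of singularities (at the first centre
meeting that fibre the strict transform was regular, `isRegular_subscheme_closure_of_centre`,
and resolves `Y`, `hasResolution_of_isIso_over_generic`).
[cite: BierstoneGrigorievMilmanWlodarczyk2011, §3.3 (2)⇒(3)⇒(4)] -/
theorem isProper_and_exists_or_hasResolution [IsLocallyNoetherian X] {Y : Scheme.{u}}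
    [IsIntegral Y] (ι : Y ⟶ X) [IsClosedImmersion ι] {T : Set X} (hT : T ⊆ Set.range ι)
    {X' : Scheme.{u}} {σ : X' ⟶ X} {Y' : Set X'}
    (h : IsEmbeddedTransform (Set.range ι) T σ Y') :
    IsProper σ ∧
      ((∃ V : X.Opens, ι (genericPoint Y) ∈ V ∧ IsIso (σ ∣_ V) ∧
          ∃ ξ' : X', σ ξ' = ι (genericPoint Y) ∧ Y' = closure {ξ'}) ∨
        Scheme.HasResolution Y) := by
  -- `ι(Y)` is the closure of `ξ`
  set ξ : X := ι (genericPoint Y) with hξdef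
  have hgen : IsGenericPoint ξ (Set.range ι) := by
    have := (genericPoint_spec Y).image ι.continuous
    rwa [Set.image_univ, ι.isClosedEmbedding.isClosed_range.closure_eq] at this
  have hYξ : Set.range ι = closure {ξ} := hgen.symm
  induction h with
  | refl =>
    refine ⟨inferInstance, Or.inl ⟨⊤, trivial, ?_, ξ, rfl, hYξ⟩⟩
    infer_instance
  | @blowup X' X'' σ Y' h C τ hτ hC hCT ih =>
    obtain ⟨hσ, hcase⟩ := ih
    haveI : IsLocallyNoetherian X' := LocallyOfFiniteType.isLocallyNoetherian σ
    haveI : IsProper τ := stacks02NS_holds.of_isLocallyNoetherian τ C hτ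
    refine ⟨inferInstance, ?_⟩
    rcases hcase with ⟨V, hξV, hiso, ξ', hξ', hY'⟩ | hres
    · -- the fibre of `σ` over `ξ` is `{ξ'}`
      have hfib : σ ⁻¹' {ξ} = {ξ'} := by
        obtain ⟨x, -, huniq⟩ := existsUnique_preimage_of_isIso_morphismRestrict σ hiso hξV
        ext z
        simp only [Set.mem_preimage, Set.mem_singleton_iff]
        exact ⟨fun hz => (huniq z hz).trans (huniq ξ' hξ').symm, fun hz => hz ▸ hξ'⟩
      -- the centre lies over `ι(Y) = closure {ξ}`
      have hCY : σ '' (C.support : Set X') ⊆ closure {ξ} := fun x hx => hYξ ▸ hT (hCT hx)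
      by_cases hξ'C : ξ' ∈ (C.support : Set X')
      · -- the centre swallows the strict transform, which is therefore regular: resolve `Y` now
        right
        have hreg := isRegular_subscheme_closure_of_centre σ V hξV hiso ξ' hξ' C hC hCY hξ'C
        haveI := hσ
        exact hasResolution_of_isIso_over_generic ι σ V hξV hiso ξ' hξ' hreg
      · -- the centre misses the fibre over `ξ`: shrink `V` and follow `ξ'` up the blow-up
        left
        have hclosed : IsClosed (σ '' (C.support : Set X')) := σ.isClosedMap _ C.support.isClosed
        let V' : X.Opens := V ⊓ ⟨(σ '' (C.support : Set X'))ᶜ, hclosed.isOpen_compl⟩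
        have hV'V : V' ≤ V := inf_le_left
        have hξV' : ξ ∈ V' := by
          refine ⟨hξV, ?_⟩
          rintro ⟨x, hxC, hx⟩
          have hx' : x ∈ σ ⁻¹' {ξ} := hx
          rw [hfib, Set.mem_singleton_iff] at hx'
          exact hξ'C (hx' ▸ hxC)
        -- `τ` is an isomorphism off the centre, in particular over `σ ⁻¹ V'`
        let Wc : X'.Opens := ⟨(C.support : Set X')ᶜ, C.support.isClosed.isOpen_compl⟩
        have hWc : IsIso (τ ∣_ Wc) := hτ.isIso_morphismRestrict disjoint_compl_left
        have hle : σ ⁻¹ᵁ V' ≤ Wc := fun x hx hxC => hx.2 ⟨x, hxC, rfl⟩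
        have hiso' : IsIso ((τ ≫ σ) ∣_ V') := by
          rw [morphismRestrict_comp]
          have h1 := isIso_morphismRestrict_of_le σ hiso hV'V
          have h2 := isIso_morphismRestrict_of_le τ hWc hle
          exact @IsIso.comp_isIso _ _ _ _ _ _ _ h2 h1
        -- the point over `ξ'`
        obtain ⟨ξ₂, hξ₂, huniq⟩ :=
          existsUnique_preimage_of_isIso_morphismRestrict τ hWc (y := ξ') hξ'C
        have hfib' : τ ⁻¹' {ξ'} = {ξ₂} := by
          ext z
          simp only [Set.mem_preimage, Set.mem_singleton_iff]
          exact ⟨fun hz => huniq z hz, fun hz => hz ▸ hξ₂⟩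
        refine ⟨V', hξV', hiso', ξ₂, by rw [Scheme.Hom.comp_apply, hξ₂, hξ'], ?_⟩
        apply le_antisymm
        · refine closure_minimal ?_ isClosed_closure
          rintro x ⟨hxY, hxC⟩
          rw [hY'] at hxY
          have hx :=
            preimage_closure_inter_subset_of_isIso_morphismRestrict τ hWc {ξ'} ⟨hxY, hxC⟩
          rwa [hfib'] at hx
        · refine closure_mono (Set.singleton_subset_iff.mpr ?_)
          refine ⟨?_, ?_⟩
          · rw [hY']
            show τ ξ₂ ∈ closure {ξ'}
            rw [hξ₂]
            exact subset_closure rfl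
          · show τ ξ₂ ∉ (C.support : Set X')
            rw [hξ₂]
            exact hξ'C
    · exact Or.inr hres

/-- **Embedded desingularization with centres over the subvariety ⇒ resolution** (BGMW §3.3
(3) ⇒ (4), generalised from "centres off the generic point" to "centres over `T ⊆ ι(Y)`", the
format of Cossart–Jannsen–Saito 2020, Thm. 1.4, whose centres lie inside the subscheme being
resolved). Let `ι : Y ↪ X` be a closed immersion of an integral scheme into a locally Noetherian
scheme, `σ : X' → X` a composite of blow-ups in regular centres lying over `T ⊆ ι(Y)`, and
`Y' ⊆ X'` the iterated strict transform of `ι(Y)`. If the reduced closed subscheme of `X'` on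
`closure Y'` is regular, then `Y` has a resolution of singularities.
[cite: BierstoneGrigorievMilmanWlodarczyk2011, §3.3 (3)⇒(4) and Thm. 2.0.3]
[cite: CossartJannsenSaito2020, Thm. 1.4] -/
theorem hasResolution_of_isEmbeddedTransform_of_subset [IsLocallyNoetherian X] {Y X' : Scheme.{u}}
    [IsIntegral Y] (ι : Y ⟶ X) [IsClosedImmersion ι] {T : Set X} (hT : T ⊆ Set.range ι)
    {σ : X' ⟶ X} {Y' : Set X'} (h : IsEmbeddedTransform (Set.range ι) T σ Y')
    (hreg : Scheme.IsRegular
      (vanishingIdeal (⟨closure Y', isClosed_closure⟩ : Closeds X')).subscheme) :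
    Scheme.HasResolution Y := by
  obtain ⟨hσ, hcase⟩ := isProper_and_exists_or_hasResolution ι hT h
  rcases hcase with ⟨V, hξV, hiso, ξ', hξ', hY'⟩ | hres
  · haveI := hσ
    have e : (⟨closure Y', isClosed_closure⟩ : Closeds X') = ⟨closure {ξ'}, isClosed_closure⟩ := by
      apply Closeds.ext
      change closure Y' = closure {ξ'}
      rw [hY', closure_closure]
    rw [e] at hreg
    exact hasResolution_of_isIso_over_generic ι σ V hξV hiso ξ' hξ' hreg
  · exact hres

/-- Registered form of `hasResolution_of_isEmbeddedTransform_of_subset` (universe `0`; stub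
`stub_hasResolution_of_isEmbeddedTransform_of_subset` of crux stmt-ResolutionOfSingularities-0642,
line `Ideator5Sketch`). [cite: BierstoneGrigorievMilmanWlodarczyk2011, §3.3 (3)⇒(4) and Thm. 2.0.3] -/
theorem stub_hasResolution_of_isEmbeddedTransform_of_subset : ∀ {X : AlgebraicGeometry.Scheme.{0}} [AlgebraicGeometry.IsLocallyNoetherian X] {Y X' : AlgebraicGeometry.Scheme.{0}} [AlgebraicGeometry.IsIntegral Y] (ι : Y ⟶ X) [AlgebraicGeometry.IsClosedImmersion ι] {T : Set X}, T ⊆ Set.range ι → ∀ {σ : X' ⟶ X} {Y' : Set X'}, Literature.AlgebraicGeometry.Resolution.IsEmbeddedTransform (Set.range ι) T σ Y' → Literature.AlgebraicGeometry.Resolution.Scheme.IsRegular (AlgebraicGeometry.Scheme.IdealSheafData.vanishingIdeal (⟨closure Y', isClosed_closure⟩ : TopologicalSpace.Closeds X')).subscheme → Literature.AlgebraicGeometry.Resolution.Scheme.HasResolution Y := by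
  intro X _ Y X' _ ι _ T hT σ Y' h hreg
  exact hasResolution_of_isEmbeddedTransform_of_subset ι hT h hreg

end Summit.ResolutionOfSingularities.ResolutionOfSingularities.Theorems

end
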